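import Summits.Parity.GeneralizedHardyLittlewood.Theorems.BeyondDiagonalBeatsQuarter.OffDiagPoissonApplied
import Summits.Parity.GeneralizedHardyLittlewood.Theorems.BeyondDiagonalBeatsQuarter.OffDiagLayersTail
import HarnessLib

/-!
# Route `PrimeLevelFamEdge`, crux K_B (stmt-Parity-20343), line `diagonal_kernel_split` rev 4, plan Ω,
# worker key **W-a — the off-diagonal ENTIRELY on the dual side: `offDiag_eq_dual`**

Assembly of Ω-d3 (`PeterssonSplit.offDiag_eq_tsum_offDiagLayer`, `offDiagLayer_eq_sum_divisors`: the explicit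
off-diagonal is the absolutely convergent sum of its Petersson layers `c = q·r`, each a finite sum over
`d₁ ∣ l`, `d₂ ∣ m` of a plain double series against one Kloosterman sum) with Ω-d5
(`OffDiag.tsum_layer_eq_tsum_boxes_dual`: a layer = Σ over dyadic boxes of the dual (Poisson) side, d1 ∘ d2 ∘ d4).
For `q` prime and `1 ≤ l, m < q`:

* `summable_layerSummand` — the re-indexed layer summand `k ↦ w_q(d₁k₁,d₂k₂)·petKloostermanTerm q ((l/d₁)k₁)((m/d₂)k₂) r`
  is absolutely summable (d3's `summable_ite_piece` transported along `n = (d₁k₁, d₂k₂)`), so every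
  summability hypothesis of d5 is DISCHARGED; `offDiagLayer_eq_dual` (one layer), `offDiagLayer_zero`;
* **`offDiag_eq_dual`**:
  `offDiag q l m = 2q̂(2π/q) · Σ_{r ≥ 1} Σ_{d₁∣l} Σ_{d₂∣m} Σ_{i ∈ ℕ²} Σ_{(h₁,h₂) ∈ ℤ²}
     Φ̂_{d₁,d₂,r,i}(h₁/(qr), h₂/(qr)) · N_{qr}(l/d₁, m/d₂; h₁, h₂)`
  (`Φ̂ = fourier2 (OffDiag.boxWeight q d₁ d₂ (l/d₁) (m/d₂) r i)`, `N = OffDiag.dualCount`; the `r`-series written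
  as `Σ_{r ∈ ℕ}` of the layer `r+1`), with the `r`-series absolutely convergent (`summable_dualLayer`);
* zero-frequency rows deleted: `dualCount_zero_right` (with d5's `dualCount_zero_left`), and for every box
  `tsum_dual_eq_tsum_nonzero(_primeLevel)`: the `h`-sum runs over `{h : (h₁ mod qr) ≠ 0 ∧ (h₂ mod qr) ≠ 0}` only
  (`α = l/d₁`, `β = m/d₂ ∈ [1,q)` are non-zero mod `qr`: d2's `natCast_ne_zero_of_lt_prime`, `one_le_div_and_div_lt`);
* the coprime stratum made explicit (GATE G2 §(a) row a6): if `α` is a unit mod `c` then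
  `N_c(α,β;h₁,h₂) = 𝟙[h₁ is a unit mod c ∧ h₁h₂ = αβ (mod c)]` (`dualCount_eq_ite_of_isUnit`); at prime level
  `α = a ∈ [1,q)` is a unit mod `qr` iff `(a,r) = 1` (`isUnit_natCast_primeLevel`,
  `dualCount_primeLevel_coprime`); and the dual congruence is the integer parametrisation
  `h₁h₂ = αβ + qr·s`, `s ∈ ℤ` (`dual_congruence_iff_exists_int`).

Exact identities and counting only; no estimate of any dual term (Ω-e/a7/f/g). Helper; closes nothing; std axioms.
«The programme SEARCHES and TYPES; no claim about Landau–Siegel zeros, Theorems 1–2 of arXiv:2211.02515 or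
a repaired Margin232 until a kernel theorem says so.»
-/

noncomputable section

open Finset Set
open scoped Real FourierTransform ContDiff

namespace Summit.Parity.GeneralizedHardyLittlewood.Theorems.BeyondDiagonalBeatsQuarter.OffDiagDual

open Literature.NumberTheory.LFunctions Literature.NumberTheory.LFunctions.KMV2000
open Literature.NumberTheory.LFunctions.KowalskiMichel2000 (petKloostermanTerm petKloostermanTerm_zero)
open Literature.NumberTheory.Sieve.FriedlanderIwaniecPrimes (fourier2)
open PeterssonSplit (afeWeight offDiag offDiagLayer offDiagTerm offDiagLayer_eq_sum_divisors
  offDiag_eq_tsum_offDiagLayer summable_ite_piece summable_offDiagLayer mul_mul_div_sq)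
open OffDiag (boxWeight dualCount tsum_layer_eq_tsum_boxes_dual summable_boxes_dual summable_dual
  dualCount_zero_left dualCount_le_one one_le_div_and_div_lt natCast_ne_zero_of_lt_prime
  h_mul_h_eq_of_mem_dualUnits mem_dualUnits)

variable {q : ℕ} [NeZero q]

/-! ### §1 The re-indexed layer summand is absolutely summable -/

/-- For `d ∣ l`, `l ≥ 1`: `1 ≤ l/d`. [folklore] -/
theorem one_le_div_of_dvd {l d : ℕ} (hd : d ∣ l) (hl : 1 ≤ l) : 1 ≤ l / d :=
  Nat.div_pos (Nat.le_of_dvd (by omega) hd) (Nat.pos_of_dvd_of_pos hd (by omega))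

/-- **All summabilities discharged.** For `q` prime, `l, m ≥ 1`, `d₁ ∣ l`, `d₂ ∣ m` and every `r`, the re-indexed
layer summand `k ↦ w_q(d₁k₁, d₂k₂) · petKloostermanTerm q ((l/d₁)k₁) ((m/d₂)k₂) r` is absolutely summable on `ℕ²`
(d3's dominated piece `summable_ite_piece`, transported along the injection `k ↦ (d₁k₁, d₂k₂)`).
[cite: KowalskiMichel2000, §2.4.2 p. 312 (23) — derivation] -/
theorem summable_layerSummand (hq : q.Prime) {l m : ℕ} (hl : 1 ≤ l) (hm : 1 ≤ m) {d₁ d₂ : ℕ}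
    (hd₁ : d₁ ∈ l.divisors) (hd₂ : d₂ ∈ m.divisors) (r : ℕ) :
    Summable (fun k : ℕ × ℕ => (afeWeight q (d₁ * k.1, d₂ * k.2) : ℂ) *
      petKloostermanTerm q (l / d₁ * k.1) (m / d₂ * k.2) r) := by
  have hd₁0 : d₁ ≠ 0 := (Nat.pos_of_mem_divisors hd₁).ne'
  have hd₂0 : d₂ ≠ 0 := (Nat.pos_of_mem_divisors hd₂).ne'
  have hinj : Function.Injective (fun k : ℕ × ℕ => (d₁ * k.1, d₂ * k.2)) := by
    intro s t hst
    simp only [Prod.mk.injEq] at hst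
    exact Prod.ext (Nat.eq_of_mul_eq_mul_left (Nat.pos_of_ne_zero hd₁0) hst.1)
      (Nat.eq_of_mul_eq_mul_left (Nat.pos_of_ne_zero hd₂0) hst.2)
  have hs := (summable_ite_piece hq hl hm (Finset.mk_mem_product hd₁ hd₂) r).comp_injective hinj
  refine hs.congr fun k => ?_
  simp only [Function.comp_apply]
  rw [if_pos ⟨Dvd.intro _ rfl, Dvd.intro _ rfl⟩, mul_mul_div_sq (Nat.dvd_of_mem_divisors hd₁) hd₁0,
    mul_mul_div_sq (Nat.dvd_of_mem_divisors hd₂) hd₂0]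

/-! ### §2 One layer on the dual side -/

/-- **One Petersson layer, entirely on the dual side.** For `q` prime, `l, m ≥ 1` and `r ≥ 1`:
`offDiagLayer q l m r = Σ_{d₁∣l} Σ_{d₂∣m} Σ_{i ∈ ℕ²} Σ_{h ∈ ℤ²} Φ̂_{d₁,d₂,r,i}(h/(qr)) · N_{qr}(l/d₁, m/d₂; h)`.
[cite: KowalskiMichelVanderKam2000, (21)–(23) p. 12 and Lemma 3.3 p. 9 — derivation] -/
theorem offDiagLayer_eq_dual (hq : q.Prime) {l m : ℕ} (hl : 1 ≤ l) (hm : 1 ≤ m) {r : ℕ} (hr : r ≠ 0)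
    [NeZero (q * r)] :
    offDiagLayer q l m r = ∑ d₁ ∈ l.divisors, ∑ d₂ ∈ m.divisors, ∑' i : ℕ × ℕ, ∑' h : ℤ × ℤ,
      fourier2 (boxWeight q d₁ d₂ (l / d₁) (m / d₂) r i) (h.1 / (q * r : ℕ)) (h.2 / (q * r : ℕ)) *
        (dualCount (q * r) ((l / d₁ : ℕ) : ZMod (q * r)) ((m / d₂ : ℕ) : ZMod (q * r))
          (h.1 : ZMod (q * r)) (h.2 : ZMod (q * r)) : ℂ) := by
  rw [offDiagLayer_eq_sum_divisors hq hl hm r]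
  refine Finset.sum_congr rfl fun d₁ hd₁ => Finset.sum_congr rfl fun d₂ hd₂ => ?_
  exact tsum_layer_eq_tsum_boxes_dual (Nat.pos_of_mem_divisors hd₁) (Nat.pos_of_mem_divisors hd₂)
    (one_le_div_of_dvd (Nat.dvd_of_mem_divisors hd₁) hl) (one_le_div_of_dvd (Nat.dvd_of_mem_divisors hd₂) hm)
    hr (summable_layerSummand hq hl hm hd₁ hd₂ r)

/-- The box series of every divisor pair converges absolutely (d5's `summable_boxes_dual`, hypothesis discharged).
[folklore] -/
theorem summable_boxes (hq : q.Prime) {l m : ℕ} (hl : 1 ≤ l) (hm : 1 ≤ m) {d₁ d₂ : ℕ}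
    (hd₁ : d₁ ∈ l.divisors) (hd₂ : d₂ ∈ m.divisors) {r : ℕ} (hr : r ≠ 0) [NeZero (q * r)] :
    Summable (fun i : ℕ × ℕ => ∑' h : ℤ × ℤ,
      fourier2 (boxWeight q d₁ d₂ (l / d₁) (m / d₂) r i) (h.1 / (q * r : ℕ)) (h.2 / (q * r : ℕ)) *
        (dualCount (q * r) ((l / d₁ : ℕ) : ZMod (q * r)) ((m / d₂ : ℕ) : ZMod (q * r))
          (h.1 : ZMod (q * r)) (h.2 : ZMod (q * r)) : ℂ)) :=
  summable_boxes_dual (Nat.pos_of_mem_divisors hd₁) (Nat.pos_of_mem_divisors hd₂)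
    (one_le_div_of_dvd (Nat.dvd_of_mem_divisors hd₁) hl) (one_le_div_of_dvd (Nat.dvd_of_mem_divisors hd₂) hm)
    hr (summable_layerSummand hq hl hm hd₁ hd₂ r)

/-! ### §3 The whole off-diagonal on the dual side -/

/-- The layer `r = 0` is empty (indexing convention of `petKloostermanTerm`). [folklore] -/
theorem offDiagLayer_zero (l m : ℕ) : offDiagLayer q l m 0 = 0 := by
  simp [offDiagLayer, offDiagTerm]

/-- The layer series from `r = 1` converges absolutely. [folklore] -/
theorem summable_offDiagLayer_succ (hq : q.Prime) {l m : ℕ} (hl : 1 ≤ l) (hm : 1 ≤ m) :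
    Summable (fun r : ℕ => offDiagLayer q l m (r + 1)) :=
  (summable_nat_add_iff 1).mpr (summable_offDiagLayer hq hl hm)

/-- `offDiag q l m = 2q̂(2π/q) · Σ_{r ∈ ℕ} offDiagLayer q l m (r+1)` (drop the empty layer `r = 0`).
[cite: KowalskiMichelVanderKam2000, (21)–(23) p. 12; KowalskiMichel2000, §2.4.2 p. 312 — derivation] -/
theorem offDiag_eq_tsum_offDiagLayer_succ (hq : q.Prime) {l m : ℕ} (hl : 1 ≤ l) (hm : 1 ≤ m) :
    offDiag q l m = 2 * (qhat q : ℂ) * (2 * π / q) * ∑' r : ℕ, offDiagLayer q l m (r + 1) := by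
  rw [offDiag_eq_tsum_offDiagLayer hq hl hm, tsum_eq_zero_add' (summable_offDiagLayer_succ hq hl hm),
    offDiagLayer_zero, zero_add]

/-- **`offDiag_eq_dual` — the explicit off-diagonal of the heart, ENTIRELY on the dual (frequency) side.** For
`q` prime and `1 ≤ l, m` (the heart uses `l, m < q`):
`offDiag q l m = 2q̂·(2π/q) · Σ_{r ∈ ℕ} Σ_{d₁∣l} Σ_{d₂∣m} Σ_{i ∈ ℕ²} Σ_{(h₁,h₂) ∈ ℤ²}
   Φ̂_{d₁,d₂,r+1,i}(h₁/(q(r+1)), h₂/(q(r+1))) · N_{q(r+1)}(l/d₁, m/d₂; h₁, h₂)`,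
`Φ̂ = fourier2 (OffDiag.boxWeight …)`, `N = OffDiag.dualCount`; every series displayed converges absolutely
(`summable_dualLayer`, `summable_boxes`, d5's `summable_dual`). GATE G2 §(a) rows a2–a5 assembled.
[cite: KowalskiMichelVanderKam2000, (21)–(23) p. 12–13 and Lemma 3.3 p. 9; KowalskiMichel2000, §2.4.2 p. 312 — derivation] -/
theorem offDiag_eq_dual (hq : q.Prime) {l m : ℕ} (hl : 1 ≤ l) (hm : 1 ≤ m) :
    offDiag q l m = 2 * (qhat q : ℂ) * (2 * π / q) * ∑' r : ℕ,
      ∑ d₁ ∈ l.divisors, ∑ d₂ ∈ m.divisors, ∑' i : ℕ × ℕ, ∑' h : ℤ × ℤ,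
        fourier2 (boxWeight q d₁ d₂ (l / d₁) (m / d₂) (r + 1) i)
            (h.1 / (q * (r + 1) : ℕ)) (h.2 / (q * (r + 1) : ℕ)) *
          (dualCount (q * (r + 1)) ((l / d₁ : ℕ) : ZMod (q * (r + 1))) ((m / d₂ : ℕ) : ZMod (q * (r + 1)))
            (h.1 : ZMod (q * (r + 1))) (h.2 : ZMod (q * (r + 1))) : ℂ) := by
  rw [offDiag_eq_tsum_offDiagLayer_succ hq hl hm]
  congr 1
  exact tsum_congr fun r => offDiagLayer_eq_dual hq hl hm (Nat.succ_ne_zero r)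

/-- The `r`-series of `offDiag_eq_dual` converges absolutely (it is the layer series). [folklore] -/
theorem summable_dualLayer (hq : q.Prime) {l m : ℕ} (hl : 1 ≤ l) (hm : 1 ≤ m) :
    Summable (fun r : ℕ => ∑ d₁ ∈ l.divisors, ∑ d₂ ∈ m.divisors, ∑' i : ℕ × ℕ, ∑' h : ℤ × ℤ,
      fourier2 (boxWeight q d₁ d₂ (l / d₁) (m / d₂) (r + 1) i)
          (h.1 / (q * (r + 1) : ℕ)) (h.2 / (q * (r + 1) : ℕ)) *
        (dualCount (q * (r + 1)) ((l / d₁ : ℕ) : ZMod (q * (r + 1))) ((m / d₂ : ℕ) : ZMod (q * (r + 1)))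
          (h.1 : ZMod (q * (r + 1))) (h.2 : ZMod (q * (r + 1))) : ℂ)) :=
  (summable_offDiagLayer_succ hq hl hm).congr fun r => offDiagLayer_eq_dual hq hl hm (Nat.succ_ne_zero r)

/-! ### §4 The zero-frequency rows are absent -/

section ZeroRows

variable {c : ℕ} [NeZero c]

/-- `N_c(α,β;h₁,0) = 0` whenever `β ≢ 0 (mod c)` (no unit `u` has `βū = 0`) — companion of d5's
`dualCount_zero_left`. [folklore] -/
theorem dualCount_zero_right {β : ZMod c} (hβ : β ≠ 0) (α h₁ : ZMod c) : dualCount c α β h₁ 0 = 0 := by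
  rw [dualCount, Finset.card_eq_zero]
  refine Finset.filter_false_of_mem fun u _ hu => hβ ?_
  have h2 := hu.2
  rw [add_zero] at h2
  simpa using congrArg (· * ((u : (ZMod c)ˣ) : ZMod c)) h2

/-- **Zero-frequency rows deleted.** For `α, β ≢ 0 (mod c)` and any weight `Φ`, the dual sum of a box runs
over the frequencies with BOTH residues non-zero:
`Σ_{h ∈ ℤ²} Φ̂(h/c)·N_c(α,β;h) = Σ_{h : h₁ ≢ 0, h₂ ≢ 0 (mod c)} Φ̂(h/c)·N_c(α,β;h)`. [folklore] -/
theorem tsum_dual_eq_tsum_nonzero {α β : ZMod c} (hα : α ≠ 0) (hβ : β ≠ 0) (Φ : ℝ → ℝ → ℂ) :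
    ∑' h : ℤ × ℤ, fourier2 Φ (h.1 / c) (h.2 / c) * (dualCount c α β (h.1 : ZMod c) (h.2 : ZMod c) : ℂ) =
      ∑' h : {h : ℤ × ℤ | (h.1 : ZMod c) ≠ 0 ∧ (h.2 : ZMod c) ≠ 0},
        fourier2 Φ (h.1.1 / c) (h.1.2 / c) * (dualCount c α β (h.1.1 : ZMod c) (h.1.2 : ZMod c) : ℂ) := by
  refine (tsum_subtype_eq_of_support_subset
    (f := fun h : ℤ × ℤ => fourier2 Φ (h.1 / c) (h.2 / c) * (dualCount c α β (h.1 : ZMod c) (h.2 : ZMod c) : ℂ))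
    (s := {h : ℤ × ℤ | (h.1 : ZMod c) ≠ 0 ∧ (h.2 : ZMod c) ≠ 0}) fun h hh => ?_).symm
  rw [Set.mem_setOf_eq]
  by_contra hne
  rw [not_and_or, not_not, not_not] at hne
  refine Function.mem_support.mp hh ?_
  rcases hne with h1 | h2
  · simp only [h1, dualCount_zero_left hα, Nat.cast_zero, mul_zero]
  · simp only [h2, dualCount_zero_right hβ, Nat.cast_zero, mul_zero]

/-- **Prime level: every box of every layer of `offDiag` has its zero-frequency rows deleted** — for `q` prime,
`1 ≤ a, b < q`, `r ≥ 1` (`a = l/d₁`, `b = m/d₂` by d2's `one_le_div_and_div_lt`) and any weight `Φ`: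
`Σ_{h ∈ ℤ²} Φ̂(h/(qr))·N_{qr}(a,b;h) = Σ_{h : h₁, h₂ ≢ 0 (mod qr)} Φ̂(h/(qr))·N_{qr}(a,b;h)`.
[cite: KowalskiMichelVanderKam2000, Lemma 3.3 p. 9 — derivation] -/
theorem tsum_dual_eq_tsum_nonzero_primeLevel {q a b r : ℕ} [NeZero (q * r)] (hq : q.Prime)
    (ha : 1 ≤ a) (haq : a < q) (hb : 1 ≤ b) (hbq : b < q) (hr : 1 ≤ r) (Φ : ℝ → ℝ → ℂ) :
    ∑' h : ℤ × ℤ, fourier2 Φ (h.1 / (q * r : ℕ)) (h.2 / (q * r : ℕ)) *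
        (dualCount (q * r) (a : ZMod (q * r)) (b : ZMod (q * r)) (h.1 : ZMod (q * r)) (h.2 : ZMod (q * r)) : ℂ) =
      ∑' h : {h : ℤ × ℤ | (h.1 : ZMod (q * r)) ≠ 0 ∧ (h.2 : ZMod (q * r)) ≠ 0},
        fourier2 Φ (h.1.1 / (q * r : ℕ)) (h.1.2 / (q * r : ℕ)) *
          (dualCount (q * r) (a : ZMod (q * r)) (b : ZMod (q * r))
            (h.1.1 : ZMod (q * r)) (h.1.2 : ZMod (q * r)) : ℂ) :=
  tsum_dual_eq_tsum_nonzero (natCast_ne_zero_of_lt_prime hq ha haq hr)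
    (natCast_ne_zero_of_lt_prime hq hb hbq hr) Φ

end ZeroRows

/-! ### §5 The coprime stratum: `N = 𝟙[h₁ unit ∧ h₁h₂ ≡ αβ]`, and `h₁h₂ = αβ + c·s` -/

section Coprime

variable {c : ℕ} [NeZero c]

/-- **The dual count on the coprime stratum.** If `α` is a unit of `ℤ/c` then
`N_c(α,β;h₁,h₂) = 1` if `h₁` is a unit and `h₁h₂ = αβ` in `ℤ/c`, and `= 0` otherwise
(the unit is forced: `u = −α⁻¹h₁`; GATE G2 §(a) row a6). [folklore] -/
theorem dualCount_eq_ite_of_isUnit {α : ZMod c} (hα : IsUnit α) (β h₁ h₂ : ZMod c) :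
    dualCount c α β h₁ h₂ = if IsUnit h₁ ∧ h₁ * h₂ = α * β then 1 else 0 := by
  classical
  split_ifs with hc
  · refine le_antisymm (dualCount_le_one hα β h₁ h₂) ?_
    obtain ⟨hu1, hprod⟩ := hc
    obtain ⟨a, rfl⟩ := hα
    obtain ⟨v, rfl⟩ := hu1
    rw [dualCount, Nat.one_le_iff_ne_zero, Ne, Finset.card_eq_zero, ← Ne, ← Finset.nonempty_iff_ne_empty]
    refine ⟨-(a⁻¹ * v), mem_dualUnits.mpr ⟨?_, ?_⟩⟩
    · have ha : ((a : ZMod c)) * ((a⁻¹ : (ZMod c)ˣ) : ZMod c) = 1 := Units.mul_inv a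
      have e : (((-(a⁻¹ * v) : (ZMod c)ˣ)) : ZMod c) = -(((a⁻¹ : (ZMod c)ˣ) : ZMod c) * (v : ZMod c)) := by
        simp
      rw [e]
      linear_combination (-(v : ZMod c)) * ha
    · have hv : ((v⁻¹ : (ZMod c)ˣ) : ZMod c) * (v : ZMod c) = 1 := Units.inv_mul v
      have e : (((-(a⁻¹ * v))⁻¹ : (ZMod c)ˣ) : ZMod c) = -(((v⁻¹ : (ZMod c)ˣ) : ZMod c) * (a : ZMod c)) := by
        simp [mul_inv_rev]
      rw [e]
      linear_combination ((v⁻¹ : (ZMod c)ˣ) : ZMod c) * hprod - h₂ * hv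
  · rw [dualCount, Finset.card_eq_zero]
    refine Finset.filter_false_of_mem fun u _ hu => hc ⟨?_, ?_⟩
    · have e1 : h₁ = -(α * (u : ZMod c)) := by linear_combination hu.1
      rw [e1]
      exact (hα.mul (Units.isUnit u)).neg
    · exact h_mul_h_eq_of_mem_dualUnits (mem_dualUnits.mpr hu)

/-- **Prime level, the unit condition**: for `q` prime, `1 ≤ a < q` and `(a, r) = 1`, `a` is a unit mod `qr`.
[folklore] -/
theorem isUnit_natCast_primeLevel {q a r : ℕ} (hq : q.Prime) (ha : 1 ≤ a) (haq : a < q)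
    (har : Nat.Coprime a r) : IsUnit ((a : ℕ) : ZMod (q * r)) := by
  rw [ZMod.isUnit_iff_coprime]
  refine Nat.Coprime.mul_right ?_ har
  exact Nat.coprime_comm.mp ((Nat.Prime.coprime_iff_not_dvd hq).mpr (Nat.not_dvd_of_pos_of_lt ha haq))

/-- Conversely `(a, r) = 1` is necessary: a unit mod `qr` is coprime to `r`. [folklore] -/
theorem coprime_of_isUnit_natCast {q a r : ℕ} (h : IsUnit ((a : ℕ) : ZMod (q * r))) : Nat.Coprime a r :=
  ((ZMod.isUnit_iff_coprime a (q * r)).mp h).coprime_mul_left_right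

/-- **Prime level, the coprime stratum of `offDiag`'s dual side**: for `q` prime, `1 ≤ a < q`, `(a, r) = 1`
(`a = l/d₁`, modulus `c = qr`) and all `b, h₁, h₂`:
`N_{qr}(a,b;h₁,h₂) = 𝟙[h₁ is a unit mod qr ∧ h₁h₂ ≡ ab (mod qr)]`. [folklore] -/
theorem dualCount_primeLevel_coprime {q a r : ℕ} [NeZero (q * r)] (hq : q.Prime) (ha : 1 ≤ a) (haq : a < q)
    (har : Nat.Coprime a r) (b : ℕ) (h₁ h₂ : ℤ) :
    dualCount (q * r) (a : ZMod (q * r)) (b : ZMod (q * r)) (h₁ : ZMod (q * r)) (h₂ : ZMod (q * r)) =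
      if IsUnit (h₁ : ZMod (q * r)) ∧
          (h₁ : ZMod (q * r)) * (h₂ : ZMod (q * r)) = (a : ZMod (q * r)) * (b : ZMod (q * r)) then 1 else 0 :=
  dualCount_eq_ite_of_isUnit (isUnit_natCast_primeLevel hq ha haq har) _ _ _

omit [NeZero c] in
/-- **The dual congruence as an integer parametrisation** (`c ≥ 1`, `a, b ∈ ℕ`, `h₁, h₂ ∈ ℤ`):
`h₁h₂ ≡ ab (mod c)` iff `h₁h₂ = ab + c·s` for some `s ∈ ℤ` (GATE G2 §(a) row a6: `h₁h₂ = A + cq·s`). [folklore] -/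
theorem dual_congruence_iff_exists_int (a b : ℕ) (h₁ h₂ : ℤ) :
    (h₁ : ZMod c) * (h₂ : ZMod c) = (a : ZMod c) * (b : ZMod c) ↔
      ∃ s : ℤ, h₁ * h₂ = (a : ℤ) * b + c * s := by
  have e : ((h₁ : ZMod c) * (h₂ : ZMod c) = (a : ZMod c) * (b : ZMod c)) ↔
      (((h₁ * h₂ : ℤ) : ZMod c) = (((a : ℤ) * b : ℤ) : ZMod c)) := by push_cast; exact Iff.rfl
  rw [e, ZMod.intCast_eq_intCast_iff_dvd_sub]
  constructor
  · rintro ⟨t, ht⟩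
    exact ⟨-t, by linarith⟩
  · rintro ⟨s, hs⟩
    exact ⟨-s, by linarith⟩


/-- **The dual sum on the coprime stratum carries no multiplicity.** If `α` is a unit of `ℤ/c` then for every
weight `Φ` and every `β`:
`Σ_{h ∈ ℤ²} Φ̂(h/c) · N_c(α,β;h) = Σ_{h ∈ ℤ² : h₁ unit mod c, h₁h₂ ≡ αβ (mod c)} Φ̂(h/c)`
(a plain sum over a union of lattice cosets; GATE G2 §(a) row a6). [folklore] -/
theorem tsum_dual_eq_tsum_stratum {α : ZMod c} (hα : IsUnit α) (β : ZMod c) (Φ : ℝ → ℝ → ℂ) :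
    ∑' h : ℤ × ℤ, fourier2 Φ (h.1 / c) (h.2 / c) * (dualCount c α β (h.1 : ZMod c) (h.2 : ZMod c) : ℂ) =
      ∑' h : {h : ℤ × ℤ | IsUnit (h.1 : ZMod c) ∧ (h.1 : ZMod c) * (h.2 : ZMod c) = α * β},
        fourier2 Φ (h.1.1 / c) (h.1.2 / c) := by
  classical
  rw [tsum_subtype {h : ℤ × ℤ | IsUnit (h.1 : ZMod c) ∧ (h.1 : ZMod c) * (h.2 : ZMod c) = α * β}
    (fun h : ℤ × ℤ => fourier2 Φ (h.1 / c) (h.2 / c))]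
  refine tsum_congr fun h => ?_
  by_cases hc : IsUnit (h.1 : ZMod c) ∧ (h.1 : ZMod c) * (h.2 : ZMod c) = α * β
  · rw [Set.indicator_of_mem (by exact hc), dualCount_eq_ite_of_isUnit hα, if_pos hc, Nat.cast_one, mul_one]
  · rw [Set.indicator_of_notMem (by exact hc), dualCount_eq_ite_of_isUnit hα, if_neg hc, Nat.cast_zero,
      mul_zero]

/-- **Prime level, coprime stratum, no multiplicity**: for `q` prime, `1 ≤ a < q`, `(a, r) = 1`, any `b` and any
weight `Φ`: `Σ_{h ∈ ℤ²} Φ̂(h/(qr)) · N_{qr}(a,b;h) = Σ_{h : h₁ unit mod qr, h₁h₂ ≡ ab (mod qr)} Φ̂(h/(qr))`. [folklore] -/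
theorem tsum_dual_eq_tsum_stratum_primeLevel {q a r : ℕ} [NeZero (q * r)] (hq : q.Prime) (ha : 1 ≤ a)
    (haq : a < q) (har : Nat.Coprime a r) (b : ℕ) (Φ : ℝ → ℝ → ℂ) :
    ∑' h : ℤ × ℤ, fourier2 Φ (h.1 / (q * r : ℕ)) (h.2 / (q * r : ℕ)) *
        (dualCount (q * r) (a : ZMod (q * r)) (b : ZMod (q * r)) (h.1 : ZMod (q * r)) (h.2 : ZMod (q * r)) : ℂ) =
      ∑' h : {h : ℤ × ℤ | IsUnit (h.1 : ZMod (q * r)) ∧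
          (h.1 : ZMod (q * r)) * (h.2 : ZMod (q * r)) = (a : ZMod (q * r)) * (b : ZMod (q * r))},
        fourier2 Φ (h.1.1 / (q * r : ℕ)) (h.1.2 / (q * r : ℕ)) :=
  tsum_dual_eq_tsum_stratum (isUnit_natCast_primeLevel hq ha haq har) _ Φ

end Coprime

end Summit.Parity.GeneralizedHardyLittlewood.Theorems.BeyondDiagonalBeatsQuarter.OffDiagDual
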